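import Summits.ResolutionOfSingularities.ResolutionOfSingularities.Theorems.FrobeniusLadderFInjectiveMacaulayficationTauFloorBXChartAlgebra
import HarnessLib

/-!
# (N2-T) The GENERIC monic tower `T₂(c, d) = k[X0..X3][t][z′]`, `t² = X0·X3`, `z′² + X0c·z′ + (X0d + t·X3²) = 0` — the common shape of the Rees charts
# `D(x̄)`, `D(ȳ)`, `D(ū)` of `Bl_τ(P2d4B)`: free & finite over `k[X0..X3]`, universal property, `X0` a non-zero-divisor, CM at EVERY prime
# (crux `FInjectiveMacaulayfication` stmt-ResolutionOfSingularities-15315, chain w45a; res-L1-w45a-plan-1 g19 RULING R19.6 (3) «(N2) ROW #3 INPUT LEGALITY → stub-2»;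
# generalises §1–§3 of `…TauFloorBXChartAlgebra` (p634333 = the case `c = 1`, `d = X1³+X2³`); seat res-L1-w45a-stub-2 g8)

[OURS · L1 W4.5a] Support file (`--supports stmt-ResolutionOfSingularities-15315 --as helper`); replaces the role of NO printed item; NOT a statement of any
manuscript; def-free; UNCONDITIONAL; characteristic-free. AI-written (AI review is weaker than expert review).

The charts of `Bl_τ X` (`X = P2d4B = V(z²+x²z+y³+u³+t⁵)`, `τ = (x̄, ȳ, ū, t̄², z̄)`) at the three linear generators `x̄, ȳ, ū` are — after ordering the base variables so
that the chart variable is `X0` and `w = t²/X0` is `X3` — the towers `D(x̄)`: `(c, d) = (1, X1³+X2³)`; `D(ȳ)`: `(c, d) = (X1², 1+X2³)`; `D(ū)`: `(c, d) = (X1², X2³+1)`,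
all over the SAME `h₁ = T² − X0X3` (so p634333's `monic_h₁`, `free_finite₁`, `t_sq_eq`, `algebraMap_tower_apply(′)`, `tower₂_ringHom_ext`, `exists_nf_of_monic_two`
are reused BY NAME) with `h₂ = Z² + (X0c·Z + (X0d + t·X3²))`.
* `root_rel_of_eq` (generic: the root of `Z² + (aZ + b)` satisfies it), `monic_h₂`, `natDegree_h₂_le`, `free_finite₂`, ★ `free_finite_tower`,
  `z_sq_eq : z̄′² = −(X̄0c̄·z̄′ + X̄0d̄ + t̄X̄3²)`, ★ `algebraMap_X0_mem_nonZeroDivisors`,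
  ★ `exists_towerLift` (UNIVERSAL PROPERTY: `g : B₀ → S`, `t₀² = g(X0)g(X3)`, `z₀² + g(X0)g(c)z₀ + (g(X0)g(d) + t₀g(X3)²) = 0` extend to `T₂ → S`),
  ★ `cmCl_localization` / `cmCl_stalk` (ONE `exact` over res-L1-w45a-stub-3's `FlatIntegralCM.cmCl_localization_of_isRegularRing`, p629082).
[cite: Matsumura1987, Thm. 17.8, Thm. 23.3 (context)] [cite: GortzWedhorn2020, (13.19) p. 415]
-/

-- single-problem summit: the doubled namespace component is forced
set_option linter.dupNamespace false

noncomputable section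

namespace Summit.ResolutionOfSingularities.ResolutionOfSingularities.Theorems.FInjectiveMacaulayfication.TauFloorBMonicTower

open MvPolynomial IsLocalization
open Summit.ResolutionOfSingularities.ResolutionOfSingularities.Theorems.FInjectiveMacaulayfication
open SliceableCentre TauFloorBXChartAlgebra

variable (k : Type) [Field k]

/-- **The root of `g = Z² + (aZ + b)` satisfies `root² + a·root + b = 0`.** [plumbing] -/
theorem root_rel_of_eq {R : Type} [CommRing R] (g : Polynomial R) (a b : R) (hg : g = Polynomial.X ^ 2 + (Polynomial.C a * Polynomial.X + Polynomial.C b)) :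
    AdjoinRoot.root g ^ 2 + AdjoinRoot.of g a * AdjoinRoot.root g + AdjoinRoot.of g b = 0 := by
  subst hg
  have h := AdjoinRoot.eval₂_root (Polynomial.X ^ 2 + (Polynomial.C a * Polynomial.X + Polynomial.C b) : Polynomial R)
  simp only [Polynomial.eval₂_add, Polynomial.eval₂_mul, Polynomial.eval₂_X_pow, Polynomial.eval₂_C, Polynomial.eval₂_X] at h
  linear_combination h

/-- `h₂ = Z² + (X0c·Z + (X0d + t·X3²))` is monic. [plumbing] -/
theorem monic_h₂ (h₁ : Polynomial (MvPolynomial (Fin 4) k)) (c d : MvPolynomial (Fin 4) k) (h₂ : Polynomial (AdjoinRoot h₁))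
    (hh₂ : h₂ = Polynomial.X ^ 2 + (Polynomial.C (algebraMap (MvPolynomial (Fin 4) k) (AdjoinRoot h₁) (X 0 * c)) * Polynomial.X +
      Polynomial.C (algebraMap (MvPolynomial (Fin 4) k) (AdjoinRoot h₁) (X 0 * d) +
        AdjoinRoot.root h₁ * algebraMap (MvPolynomial (Fin 4) k) (AdjoinRoot h₁) (X 3 ^ 2)))) : h₂.Monic := by
  rw [hh₂]
  nontriviality (AdjoinRoot h₁)
  refine Polynomial.monic_X_pow_add ?_
  refine (Polynomial.degree_add_le _ _).trans_lt ?_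
  refine max_lt ((Polynomial.degree_C_mul_X_le _).trans_lt (by exact_mod_cast Nat.lt_succ_self 1)) ?_
  exact (Polynomial.degree_C_le).trans_lt (by exact_mod_cast Nat.succ_pos 1)

/-- `natDegree h₂ ≤ 2`. [plumbing] -/
theorem natDegree_h₂_le (h₁ : Polynomial (MvPolynomial (Fin 4) k)) (c d : MvPolynomial (Fin 4) k) (h₂ : Polynomial (AdjoinRoot h₁))
    (hh₂ : h₂ = Polynomial.X ^ 2 + (Polynomial.C (algebraMap (MvPolynomial (Fin 4) k) (AdjoinRoot h₁) (X 0 * c)) * Polynomial.X +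
      Polynomial.C (algebraMap (MvPolynomial (Fin 4) k) (AdjoinRoot h₁) (X 0 * d) +
        AdjoinRoot.root h₁ * algebraMap (MvPolynomial (Fin 4) k) (AdjoinRoot h₁) (X 3 ^ 2)))) : h₂.natDegree ≤ 2 := by
  rw [hh₂]
  refine (Polynomial.natDegree_add_le _ _).trans (max_le (Polynomial.natDegree_X_pow_le 2) ?_)
  refine (Polynomial.natDegree_add_le _ _).trans (max_le ((Polynomial.natDegree_C_mul_le _ _).trans (Polynomial.natDegree_X_le.trans one_le_two)) ?_)
  rw [Polynomial.natDegree_C]; exact Nat.zero_le _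

/-- `T₂` is free and finite over `T₁`. [Mathlib `AdjoinRoot.powerBasis'`] -/
theorem free_finite₂ (h₁ : Polynomial (MvPolynomial (Fin 4) k)) (c d : MvPolynomial (Fin 4) k) (h₂ : Polynomial (AdjoinRoot h₁))
    (hh₂ : h₂ = Polynomial.X ^ 2 + (Polynomial.C (algebraMap (MvPolynomial (Fin 4) k) (AdjoinRoot h₁) (X 0 * c)) * Polynomial.X +
      Polynomial.C (algebraMap (MvPolynomial (Fin 4) k) (AdjoinRoot h₁) (X 0 * d) +
        AdjoinRoot.root h₁ * algebraMap (MvPolynomial (Fin 4) k) (AdjoinRoot h₁) (X 3 ^ 2)))) :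
    Module.Free (AdjoinRoot h₁) (AdjoinRoot h₂) ∧ Module.Finite (AdjoinRoot h₁) (AdjoinRoot h₂) :=
  ⟨Module.Free.of_basis (AdjoinRoot.powerBasis' (monic_h₂ k h₁ c d h₂ hh₂)).basis, (AdjoinRoot.powerBasis' (monic_h₂ k h₁ c d h₂ hh₂)).finite⟩

/-- ★ **`T₂(c, d)` is FREE and FINITE over `B₀ = k[X0..X3]`** (monic tower). [folklore] -/
theorem free_finite_tower (h₁ : Polynomial (MvPolynomial (Fin 4) k)) (hh₁ : h₁ = Polynomial.X ^ 2 - Polynomial.C (X 0 * X 3))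
    (c d : MvPolynomial (Fin 4) k) (h₂ : Polynomial (AdjoinRoot h₁))
    (hh₂ : h₂ = Polynomial.X ^ 2 + (Polynomial.C (algebraMap (MvPolynomial (Fin 4) k) (AdjoinRoot h₁) (X 0 * c)) * Polynomial.X +
      Polynomial.C (algebraMap (MvPolynomial (Fin 4) k) (AdjoinRoot h₁) (X 0 * d) +
        AdjoinRoot.root h₁ * algebraMap (MvPolynomial (Fin 4) k) (AdjoinRoot h₁) (X 3 ^ 2)))) :
    Module.Free (MvPolynomial (Fin 4) k) (AdjoinRoot h₂) ∧ Module.Finite (MvPolynomial (Fin 4) k) (AdjoinRoot h₂) := by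
  obtain ⟨hf₁, hfi₁⟩ := free_finite₁ k h₁ hh₁
  obtain ⟨hf₂, hfi₂⟩ := free_finite₂ k h₁ c d h₂ hh₂
  exact ⟨Module.Free.trans (S := AdjoinRoot h₁), Module.Finite.trans (AdjoinRoot h₁) (AdjoinRoot h₂)⟩

/-- `z̄′² = −(X̄0·c̄·z̄′ + X̄0·d̄ + t̄·X̄3²)` in `T₂`. [plumbing] -/
theorem z_sq_eq (h₁ : Polynomial (MvPolynomial (Fin 4) k)) (c d : MvPolynomial (Fin 4) k) (h₂ : Polynomial (AdjoinRoot h₁))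
    (hh₂ : h₂ = Polynomial.X ^ 2 + (Polynomial.C (algebraMap (MvPolynomial (Fin 4) k) (AdjoinRoot h₁) (X 0 * c)) * Polynomial.X +
      Polynomial.C (algebraMap (MvPolynomial (Fin 4) k) (AdjoinRoot h₁) (X 0 * d) +
        AdjoinRoot.root h₁ * algebraMap (MvPolynomial (Fin 4) k) (AdjoinRoot h₁) (X 3 ^ 2)))) :
    AdjoinRoot.root h₂ ^ 2 = -(algebraMap (MvPolynomial (Fin 4) k) (AdjoinRoot h₂) (X 0) * algebraMap (MvPolynomial (Fin 4) k) (AdjoinRoot h₂) c * AdjoinRoot.root h₂ + algebraMap (MvPolynomial (Fin 4) k) (AdjoinRoot h₂) (X 0) * algebraMap (MvPolynomial (Fin 4) k) (AdjoinRoot h₂) d +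
      AdjoinRoot.of h₂ (AdjoinRoot.root h₁) * algebraMap (MvPolynomial (Fin 4) k) (AdjoinRoot h₂) (X 3) ^ 2) := by
  have h := root_rel_of_eq h₂ _ _ hh₂
  simp only [map_add, map_mul, map_pow, ← algebraMap_tower_apply'] at h
  linear_combination h

/-- ★ `X̄0` is a NON-ZERO-DIVISOR of `T₂(c, d)` (free ⇒ flat over the domain `B₀`). [folklore] -/
theorem algebraMap_X0_mem_nonZeroDivisors (h₁ : Polynomial (MvPolynomial (Fin 4) k)) (hh₁ : h₁ = Polynomial.X ^ 2 - Polynomial.C (X 0 * X 3))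
    (c d : MvPolynomial (Fin 4) k) (h₂ : Polynomial (AdjoinRoot h₁))
    (hh₂ : h₂ = Polynomial.X ^ 2 + (Polynomial.C (algebraMap (MvPolynomial (Fin 4) k) (AdjoinRoot h₁) (X 0 * c)) * Polynomial.X +
      Polynomial.C (algebraMap (MvPolynomial (Fin 4) k) (AdjoinRoot h₁) (X 0 * d) +
        AdjoinRoot.root h₁ * algebraMap (MvPolynomial (Fin 4) k) (AdjoinRoot h₁) (X 3 ^ 2)))) :
    algebraMap (MvPolynomial (Fin 4) k) (AdjoinRoot h₂) (X 0) ∈ nonZeroDivisors (AdjoinRoot h₂) := by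
  obtain ⟨hfree, -⟩ := free_finite_tower k h₁ hh₁ c d h₂ hh₂
  exact FlatIntegralCM.mem_nonZeroDivisors_algebraMap_of_flat_of_ne_zero (X_ne_zero 0)

/-- ★ **UNIVERSAL PROPERTY OF `T₂(c, d)`** (existence): `g : B₀ → S` and `t₀, z₀ ∈ S` with `t₀² = g(X0)g(X3)` and `z₀² + g(X0)g(c)z₀ + (g(X0)g(d) + t₀g(X3)²) = 0`
extend to `κ : T₂ → S` with `κ|B₀ = g`, `κ(t̄) = t₀`, `κ(z̄′) = z₀`. [folklore: `AdjoinRoot.lift` twice] -/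
theorem exists_towerLift {S : Type} [CommRing S] (h₁ : Polynomial (MvPolynomial (Fin 4) k)) (hh₁ : h₁ = Polynomial.X ^ 2 - Polynomial.C (X 0 * X 3))
    (c d : MvPolynomial (Fin 4) k) (h₂ : Polynomial (AdjoinRoot h₁))
    (hh₂ : h₂ = Polynomial.X ^ 2 + (Polynomial.C (algebraMap (MvPolynomial (Fin 4) k) (AdjoinRoot h₁) (X 0 * c)) * Polynomial.X +
      Polynomial.C (algebraMap (MvPolynomial (Fin 4) k) (AdjoinRoot h₁) (X 0 * d) +
        AdjoinRoot.root h₁ * algebraMap (MvPolynomial (Fin 4) k) (AdjoinRoot h₁) (X 3 ^ 2))))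
    (g : MvPolynomial (Fin 4) k →+* S) (t₀ z₀ : S) (ht : t₀ ^ 2 = g (X 0) * g (X 3))
    (hz : z₀ ^ 2 + g (X 0) * g c * z₀ + (g (X 0) * g d + t₀ * g (X 3) ^ 2) = 0) :
    ∃ κ : AdjoinRoot h₂ →+* S, κ.comp (algebraMap (MvPolynomial (Fin 4) k) (AdjoinRoot h₂)) = g ∧
      κ (AdjoinRoot.of h₂ (AdjoinRoot.root h₁)) = t₀ ∧ κ (AdjoinRoot.root h₂) = z₀ := by
  have e1 : Polynomial.eval₂ g t₀ h₁ = 0 := by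
    rw [hh₁, Polynomial.eval₂_sub, Polynomial.eval₂_X_pow, Polynomial.eval₂_C, map_mul, ht, sub_self]
  have hκ₁of : ∀ b, AdjoinRoot.lift g t₀ e1 (AdjoinRoot.of h₁ b) = g b := fun b => AdjoinRoot.lift_of e1
  have hκ₁root : AdjoinRoot.lift g t₀ e1 (AdjoinRoot.root h₁) = t₀ := AdjoinRoot.lift_root e1
  have e2 : Polynomial.eval₂ (AdjoinRoot.lift g t₀ e1) z₀ h₂ = 0 := by
    rw [hh₂]
    simp only [Polynomial.eval₂_add, Polynomial.eval₂_mul, Polynomial.eval₂_pow, Polynomial.eval₂_C, Polynomial.eval₂_X,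
      AdjoinRoot.algebraMap_eq, map_add, map_mul, map_pow, hκ₁of, hκ₁root]
    linear_combination hz
  refine ⟨AdjoinRoot.lift _ z₀ e2, RingHom.ext fun b => ?_, ?_, AdjoinRoot.lift_root e2⟩
  · rw [RingHom.comp_apply, algebraMap_tower_apply, AdjoinRoot.lift_of e2, hκ₁of]
  · rw [AdjoinRoot.lift_of e2, hκ₁root]

/-- ★ **CM AT EVERY PRIME OF `T₂(c, d)`** — ONE `exact` over res-L1-w45a-stub-3's engine (`T₂` is Noetherian, free ⇒ flat, finite ⇒ integral over the REGULAR
ring `k[X0..X3]`). [cite: Matsumura1987, Thm. 17.8, Thm. 23.3 (context)] -/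
theorem cmCl_localization (h₁ : Polynomial (MvPolynomial (Fin 4) k)) (hh₁ : h₁ = Polynomial.X ^ 2 - Polynomial.C (X 0 * X 3))
    (c d : MvPolynomial (Fin 4) k) (h₂ : Polynomial (AdjoinRoot h₁))
    (hh₂ : h₂ = Polynomial.X ^ 2 + (Polynomial.C (algebraMap (MvPolynomial (Fin 4) k) (AdjoinRoot h₁) (X 0 * c)) * Polynomial.X +
      Polynomial.C (algebraMap (MvPolynomial (Fin 4) k) (AdjoinRoot h₁) (X 0 * d) +
        AdjoinRoot.root h₁ * algebraMap (MvPolynomial (Fin 4) k) (AdjoinRoot h₁) (X 3 ^ 2))))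
    (Q : Ideal (AdjoinRoot h₂)) [Q.IsPrime] : CMCl (Localization.AtPrime Q) := by
  obtain ⟨hfree, hfin⟩ := free_finite_tower k h₁ hh₁ c d h₂ hh₂
  haveI : Algebra.IsIntegral (MvPolynomial (Fin 4) k) (AdjoinRoot h₂) := Algebra.IsIntegral.of_finite _ _
  exact FlatIntegralCM.cmCl_localization_of_isRegularRing (A := MvPolynomial (Fin 4) k) Q

/-- Stalk form: the CM clause at EVERY point of `Spec T₂(c, d)`. [folklore transport] -/
theorem cmCl_stalk (h₁ : Polynomial (MvPolynomial (Fin 4) k)) (hh₁ : h₁ = Polynomial.X ^ 2 - Polynomial.C (X 0 * X 3))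
    (c d : MvPolynomial (Fin 4) k) (h₂ : Polynomial (AdjoinRoot h₁))
    (hh₂ : h₂ = Polynomial.X ^ 2 + (Polynomial.C (algebraMap (MvPolynomial (Fin 4) k) (AdjoinRoot h₁) (X 0 * c)) * Polynomial.X +
      Polynomial.C (algebraMap (MvPolynomial (Fin 4) k) (AdjoinRoot h₁) (X 0 * d) +
        AdjoinRoot.root h₁ * algebraMap (MvPolynomial (Fin 4) k) (AdjoinRoot h₁) (X 3 ^ 2))))
    (w : AlgebraicGeometry.Spec (.of (AdjoinRoot h₂))) : CMCl ((AlgebraicGeometry.Spec (.of (AdjoinRoot h₂))).presheaf.stalk w) := by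
  obtain ⟨hfree, hfin⟩ := free_finite_tower k h₁ hh₁ c d h₂ hh₂
  haveI : Algebra.IsIntegral (MvPolynomial (Fin 4) k) (AdjoinRoot h₂) := Algebra.IsIntegral.of_finite _ _
  exact FlatIntegralCM.cmCl_stalk_Spec_of_isRegularRing (A := MvPolynomial (Fin 4) k) w

end Summit.ResolutionOfSingularities.ResolutionOfSingularities.Theorems.FInjectiveMacaulayfication.TauFloorBMonicTower

end
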